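/-
Copyright (c) 2026 the pub-hodgecm-mathlib formalisation cell (harness21).  Prover seat hodgecm-mathlib-LH4-p13 (g6), req620 Track A «(D-RAM) FOUR-FRAME» squad, unit U2H:
the (ρ2b′-X) child `stub_U2H_fixedPointCensus_typeTwo_unit0` (U2H :418) — organ S9 (O-Sign), the CM-LETTER Hilbert-symbol steps shared by all descent types: `(β, θ)_v = (x, θ)_v`
(the token is the depth letter up to a deep norm) and the RamK conversion `(x, θ)_v = (N_{K♮∕F}κ, θ)_v` from ★ p857819 §2's identity `x·N₁·N₂ = −θ·N(κ)`.  2026-09-04.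
-/
import Summits.HodgeConjecture.HodgeConjecture.Theorems.F0P3cDyRamTokenSignUnr   -- ★ p857454 (this lineage, g5): §1 descent, §3 `hilbertSymbol_eq_one_of_valued_toPlace_sub_one_le`, §4 `exists_normOne_sqrt`; brings ★ HilbertSymbolBilinear, ★ `hilbertSymbol_self_neg`
import HarnessLib

/-!
# Crux `H413`, line LH4 «(D-RAM) FOUR-FRAME» — unit U2H, (ρ2b′-X): organ S9 in CM letters — `(β, θ)_v = (x, θ)_v`, and `(x, θ)_v = (N κ, θ)_v` from `x·N₁·N₂ = −θ·Nκ`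

Cell `hodgecm-mathlib` (D-0151), FLOOR 0, crux item H413 = `stmt-HodgeConjecture-24833`, route of record `HCCMUnconditional`; squad F0∕P3c∕LH4; registered stub served:
`F0P3cDyRamFourFrameU2H.stub_U2H_fixedPointCensus_typeTwo_unit0` ((ρ2b′-X), U2H :418) through LH4-p14's HEAD-OF-ORGANS (socket (C): the sign `(β, θ)_v` of the census with
`ι β = −χ(u² + D)∕(2u²D)`).  THEOREMS ONLY (no `def`, no instance, no notation, no `sorry`); lane `--supports stmt-HodgeConjecture-24833` (count-neutral).
* §1 `hilbertSymbol_token_eq_hilbertSymbol_depth` — TYPE-FREE: at a non-split wild ramified `w ∣ v` with datum `(σ_w, ϖ, d, t_E)`, for norm-one `u, D`, `χ ≠ 0`, `δ ∈ L_w¹` with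
  `δ² = D`, deep `u∕δ` (`|u∕δ − 1| ≤ |ϖ|^n`, `2d + t_E ≤ 2n + 1`, `2t_E < n`): **`(β, θ)_v = (x, θ)_v`** where `ι x = −χ∕(uδ)` — ★ p857454's factorisation `β = x·y`,
  `ι y = (u′ + 1∕u′)∕2` within `|ϖ|^{2n − t_E}` of `1`, hence `(y, θ)_v = 1` (★ §3).  (★ p857550 continues to `(a, −θ)(x, a)`; the RamK and RamM branches stop HERE and evaluate `(x, θ)_v`.)
* §2 `hilbertSymbol_eq_of_mul_mul_eq_neg_mul` — pure symbol algebra in `F_v`: `x·N₁·N₂ = −(θ·N)`, all non-zero, `(N₁, θ)_v = (N₂, θ)_v = 1` ⇒ **`(x, θ)_v = (N, θ)_v`**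
  (bimultiplicativity ★ `hilbertSymbol_adicCompletion_mul_left`, `(−θ, θ)_v = 1` ★ `hilbertSymbol_self_neg`).  For RamK: `N = N_{K♮∕F}(κ·π₂^j)` (★ p857819 §2 ∕ §4, transported
  along `jE ∘ ι` by injectivity), `N₂ = N_{E∕F}(1+u′)` a norm from `L_w` (★ `hilbertSymbol_eq_one_iff_exists_norm_toPlace`), `N₁ = N_{K∕F}(1+λ′)∕4 = 1 − N(λ′−1)∕4` a deep unit (★ §3) —
  so `(β, θ)_v = (x, θ)_v = (N_{K♮∕F}(κπ₂^j), θ)_v = [κπ₂^j ∈ N_{M∕K♮}] = ` the alive side of the far RamK cells (★ p857819 §5, ★ p857901).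
HONEST LABEL.  Count-neutral helper; (ρ2b′-X) OPEN; `HC_CM` is proved only modulo the 7 printed citations (2 remaining named inputs: hLiu418 = `stmt-HodgeConjecture-24832`, h413 =
`stmt-HodgeConjecture-24833`) until rung 0 closes.

## References
* [Rogawski1990] J. D. Rogawski, *Automorphic Representations of Unitary Groups in Three Variables*, Ann. of Math. Stud. 123 (1990), §4.9 p. 55, Lemma 4.9.3 p. 56.
* [LabesseLanglands1979] J.-P. Labesse, R. P. Langlands, *L-indistinguishability for SL(2)*, Canad. J. Math. 31 (1979), §2 (2.1)–(2.2).
* [Omeara1963] O. T. O'Meara, *Introduction to Quadratic Forms*, Grundlehren 117 (1963), §63B (63:10–63:13a).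
* [Serre1979] J.-P. Serre, *Local Fields*, GTM 67 (1979), Ch. V §3 Cor. 2–3; Ch. XIV §3–§4.
-/

set_option autoImplicit false

noncomputable section

open NumberField IsDedekindDomain WithZero
open Literature.NumberTheory.Automorphic Literature.NumberTheory.Automorphic.UnitaryGroup Literature.NumberTheory.GaloisRepresentations
open Literature.NumberTheory.QuadraticForms Literature.NumberTheory.Rogawski1990
open Literature.NumberTheory.Automorphic.UnitaryThreeFourFrame Literature.NumberTheory.LocalFields.WildQuadraticDatum
open Summit.HodgeConjecture.HodgeConjecture.Cruxes.H413.F0P3cDyRamTokenSignUnr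

namespace Summit.HodgeConjecture.HodgeConjecture.Cruxes.H413.F0P3cDyRamTokenSignDepthSymbol

variable (L : Type) [Field L] [NumberField L] [IsCMField L] {v : HeightOneSpectrum (𝓞 ↥(maximalRealSubfield L))}
  (w : PlacesOver L v) (hw : IsCMField.complexConj L • w.1 = w.1)

omit [IsCMField L] in
/-- `σx·x = 1` with `σ` isometric ⇒ `|x| = 1`. [folklore] -/
theorem valued_eq_one_of_map_mul_self {σ : w.1.adicCompletion L →+* w.1.adicCompletion L} (hσv : ∀ x, Valued.v (σ x) = Valued.v x)
    {x : w.1.adicCompletion L} (h : σ x * x = 1) : Valued.v x = 1 := by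
  have hx0 : x ≠ 0 := fun h0 => by rw [h0, mul_zero] at h; exact zero_ne_one h
  have hvx0 : Valued.v x ≠ 0 := (Valuation.ne_zero_iff _).2 hx0
  have h2 : Valued.v x ^ 2 = 1 := by
    rw [sq]
    nth_rewrite 1 [← hσv x]
    rw [← Valuation.map_mul, h, Valuation.map_one]
  have hlog : log (Valued.v x) = 0 := by
    have h3 := congrArg log h2
    rw [log_pow, log_one] at h3
    simpa using h3
  have h3 : exp (log (Valued.v x)) = Valued.v x := exp_log hvx0
  rw [hlog, exp_zero] at h3
  exact h3.symm

/-! ## §1 `(β, θ)_v = (x, θ)_v` — the token is the depth letter up to a deep norm (type-free) -/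

include hw in
/-- **`(β, θ)_v = (x, θ)_v`.**  At a non-split wild ramified `w ∣ v` with datum `(σ_w, ϖ, d, t_E)`: for norm-one `u, D ∈ L_w`, `χ ≠ 0`, `δ ∈ L_w¹` with `δ² = D`, deep
`|u∕δ − 1| ≤ |ϖ|^n` (`2d + t_E ≤ 2n + 1`, `2t_E < n`), the token `β` (`ι β = −χ(u² + D)∕(2u²D)`) and the depth letter `x` (`ι x = −χ∕(uδ)`) have the SAME symbol against `θ`:
`β = x·y` with `ι y = (u′ + 1∕u′)∕2`, `u′ = u∕δ`, and `(y, θ)_v = 1` (`|ι y − 1| ≤ |ϖ|^{2n − t_E}`, ★ §3 of p857454).  Descent types U ∕ RamK ∕ RamM alike.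
[cite: Rogawski1990, §4.9 p. 55, Lemma 4.9.3 p. 56] [cite: LabesseLanglands1979, §2 (2.1)–(2.2)] [cite: Omeara1963, §63B 63:10–63:13a] -/
theorem hilbertSymbol_token_eq_hilbertSymbol_depth
    (ϖ : w.1.adicCompletion L) (d tE : ℕ) (hD : IsRamifiedQuadraticDatum (galAdicCompletionMap (L := L) (IsCMField.complexConj L) hw) ϖ d tE)
    {u D χ δ : w.1.adicCompletion L}
    (hσu : galAdicCompletionMap (L := L) (IsCMField.complexConj L) hw u * u = 1)
    (hδ : δ * δ = D) (hσδ : galAdicCompletionMap (L := L) (IsCMField.complexConj L) hw δ * δ = 1) (hχ0 : χ ≠ 0)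
    {n : ℕ} (hn : 2 * d + tE ≤ 2 * n + 1) (hn4 : 2 * tE < n) (hdeep : Valued.v (u / δ - 1) ≤ Valued.v ϖ ^ n)
    {β : v.adicCompletion ↥(maximalRealSubfield L)} (hβ : toPlace v w β = -(χ * (u ^ 2 + D)) / (2 * u ^ 2 * D))
    {x : v.adicCompletion ↥(maximalRealSubfield L)} (hx : toPlace v w x = -χ / (u * δ)) :
    hilbertSymbol (v.adicCompletion ↥(maximalRealSubfield L)) β
        (algebraMap ↥(maximalRealSubfield L) _ ((cmQuadraticGenerator L : 𝓞 ↥(maximalRealSubfield L)) : ↥(maximalRealSubfield L))) =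
      hilbertSymbol (v.adicCompletion ↥(maximalRealSubfield L)) x
        (algebraMap ↥(maximalRealSubfield L) _ ((cmQuadraticGenerator L : 𝓞 ↥(maximalRealSubfield L)) : ↥(maximalRealSubfield L))) := by
  haveI : CharZero (v.adicCompletion ↥(maximalRealSubfield L)) :=
    charZero_of_injective_algebraMap (algebraMap ↥(maximalRealSubfield L) (v.adicCompletion ↥(maximalRealSubfield L))).injective
  obtain ⟨hσσ, hσv, hϖ, hfix, hϖσ, hd1, h2t⟩ := hD
  set σ := galAdicCompletionMap (L := L) (IsCMField.complexConj L) hw with hσdef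
  set θv : v.adicCompletion ↥(maximalRealSubfield L) :=
    algebraMap ↥(maximalRealSubfield L) _ ((cmQuadraticGenerator L : 𝓞 ↥(maximalRealSubfield L)) : ↥(maximalRealSubfield L)) with hθvdef
  have hι : Function.Injective (toPlace v w) := (toPlace v w).injective
  have hvu : Valued.v u = 1 := valued_eq_one_of_map_mul_self L w hσv hσu
  have hvδ : Valued.v δ = 1 := valued_eq_one_of_map_mul_self L w hσv hσδ
  have hu0 : u ≠ 0 := fun h0 => by rw [h0, map_zero] at hvu; exact zero_ne_one hvu
  have hδ0 : δ ≠ 0 := fun h0 => by rw [h0, map_zero] at hvδ; exact zero_ne_one hvδ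
  have h20 : (2 : w.1.adicCompletion L) ≠ 0 := by
    rw [← map_ofNat (algebraMap L (w.1.adicCompletion L)) 2]; exact (map_ne_zero _).2 two_ne_zero
  have hθ0 : θv ≠ 0 := by
    rw [hθvdef, Ne, map_eq_zero_iff _ (algebraMap ↥(maximalRealSubfield L) (v.adicCompletion ↥(maximalRealSubfield L))).injective]
    exact fun h => not_isSquare_cmQuadraticGenerator L (by rw [h]; exact IsSquare.zero)
  set u' : w.1.adicCompletion L := u / δ with hu'def
  have hu'0 : u' ≠ 0 := div_ne_zero hu0 hδ0
  have hσU : σ u' * u' = 1 := by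
    rw [hu'def, map_div₀, div_mul_div_comm, hσu, hσδ, div_one]
  have hσU' : σ u' = u'⁻¹ := eq_inv_of_mul_eq_one_left hσU
  have hvu' : Valued.v u' = 1 := valued_eq_one_of_map_mul_self L w hσv hσU
  -- `x ≠ 0`
  have hx0 : x ≠ 0 := fun h0 => by
    have h := hx
    rw [h0, map_zero] at h
    exact div_ne_zero (neg_ne_zero.2 hχ0) (mul_ne_zero hu0 hδ0) h.symm
  -- `y`, a deep `σ_w`-fixed unit, hence a norm
  obtain ⟨y, hy⟩ : ∃ y : v.adicCompletion ↥(maximalRealSubfield L), toPlace v w y = (u' + u'⁻¹) / 2 := by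
    refine exists_toPlace_eq_of_fixed L w hw _ ?_
    rw [map_div₀, map_add, map_inv₀, hσU', inv_inv, map_ofNat, add_comm]
  have hιy1 : toPlace v w y - 1 = (u' - 1) ^ 2 / (2 * u') := by rw [hy]; field_simp; ring
  have htE2n : tE ≤ 2 * n := by omega
  have hvy1 : Valued.v (toPlace v w y - 1) ≤ Valued.v ϖ ^ (2 * n - tE) := by
    rw [hιy1, Valuation.map_div, Valuation.map_mul, Valuation.map_pow, h2t, hvu', mul_one, hϖ, ← exp_nsmul, ← exp_nsmul,
      div_eq_mul_inv, ← exp_neg]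
    have h1 : Valued.v (u' - 1) ^ 2 ≤ exp (-(n : ℤ)) ^ 2 := by
      have h := hdeep
      rw [hϖ, ← exp_nsmul] at h
      simp only [nsmul_eq_mul, mul_neg, mul_one] at h
      exact pow_le_pow_left' h 2
    calc Valued.v (u' - 1) ^ 2 * exp (-(tE • (-1 : ℤ))) ≤ exp (-(n : ℤ)) ^ 2 * exp (-(tE • (-1 : ℤ))) := by
          gcongr
      _ = exp ((2 * n - tE : ℕ) • (-1 : ℤ)) := by
          rw [← exp_nsmul, ← exp_add]
          congr 1
          simp only [nsmul_eq_mul, mul_neg, mul_one, neg_neg]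
          push_cast [Nat.cast_sub htE2n]
          ring
  have hyθ : hilbertSymbol (v.adicCompletion ↥(maximalRealSubfield L)) y θv = 1 :=
    hilbertSymbol_eq_one_of_valued_toPlace_sub_one_le L w hw ϖ d tE ⟨hσσ, hσv, hϖ, hfix, hϖσ, hd1, h2t⟩ (by omega) hvy1
  have hy0 : y ≠ 0 := by
    rintro rfl
    have h := hvy1
    rw [map_zero, zero_sub, Valuation.map_neg, Valuation.map_one, hϖ, ← exp_nsmul, ← exp_zero, exp_le_exp, nsmul_eq_mul] at h
    have h2 : (1 : ℤ) ≤ ((2 * n - tE : ℕ) : ℤ) := by omega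
    have h3 : ((2 * n - tE : ℕ) : ℤ) * (-1 : ℤ) < 0 := by omega
    exact absurd h (not_le.2 h3)
  -- `β = x·y`
  have hβxy : β = x * y := by
    apply hι
    rw [map_mul, hx, hy, hu'def, hβ, ← hδ]
    field_simp
  rw [hβxy, hilbertSymbol_adicCompletion_mul_left ↥(maximalRealSubfield L) v hx0 hy0 hθ0, hyθ, mul_one]

/-! ## §2 `(x, θ)_v = (N, θ)_v` from `x·N₁·N₂ = −θ·N` with `(N₁, θ)_v = (N₂, θ)_v = 1` -/

omit [IsCMField L] in
/-- **SYMBOL ALGEBRA FOR THE RamK SIGN.**  In `F_v`: if `x·N₁·N₂ = −(θ·N)` with `x, N₁, N₂, N, θ ≠ 0` and `(N₁, θ)_v = (N₂, θ)_v = 1`, then `(x, θ)_v = (N, θ)_v` — bimultiplicativity and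
`(−θ, θ)_v = 1`.  RamK use (★ p857819 §2, transported along `jE ∘ ι_w` by injectivity): `x` the depth letter, `N = N_{K♮∕F}(κ·π₂^j)`, `N₁ = N_{K∕F}(1+λ′)∕(4π₂^{2j})`-type deep unit
(★ p857454 §3 ⇒ symbol `1`), `N₂ = N_{E∕F}(1+u′)` a norm from `L_w` (★ `hilbertSymbol_eq_one_iff_exists_norm_toPlace` ⇒ symbol `1`); then `(β, θ)_v = (x, θ)_v = (N, θ)_v` is the
`K♮`-norm class of `κπ₂^j`, i.e. the alive side of the far cells (★ p857819 §5, ★ p857901). [cite: Omeara1963, §63B 63:10–63:13a] [cite: Serre1979, Ch. XIV §3] -/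
theorem hilbertSymbol_eq_of_mul_mul_eq_neg_mul {x N₁ N₂ N θ : v.adicCompletion ↥(maximalRealSubfield L)}
    (hx0 : x ≠ 0) (hN₁0 : N₁ ≠ 0) (hN₂0 : N₂ ≠ 0) (hN0 : N ≠ 0) (hθ0 : θ ≠ 0)
    (h : x * N₁ * N₂ = -(θ * N))
    (h₁ : hilbertSymbol (v.adicCompletion ↥(maximalRealSubfield L)) N₁ θ = 1) (h₂ : hilbertSymbol (v.adicCompletion ↥(maximalRealSubfield L)) N₂ θ = 1) :
    hilbertSymbol (v.adicCompletion ↥(maximalRealSubfield L)) x θ = hilbertSymbol (v.adicCompletion ↥(maximalRealSubfield L)) N θ := by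
  haveI : CharZero (v.adicCompletion ↥(maximalRealSubfield L)) :=
    charZero_of_injective_algebraMap (algebraMap ↥(maximalRealSubfield L) (v.adicCompletion ↥(maximalRealSubfield L))).injective
  have hneg : -(θ * N) = (-θ) * N := by ring
  have hL : hilbertSymbol (v.adicCompletion ↥(maximalRealSubfield L)) (x * N₁ * N₂) θ = hilbertSymbol (v.adicCompletion ↥(maximalRealSubfield L)) x θ := by
    rw [hilbertSymbol_adicCompletion_mul_left ↥(maximalRealSubfield L) v (mul_ne_zero hx0 hN₁0) hN₂0 hθ0,
      hilbertSymbol_adicCompletion_mul_left ↥(maximalRealSubfield L) v hx0 hN₁0 hθ0, h₁, h₂, mul_one, mul_one]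
  have hR : hilbertSymbol (v.adicCompletion ↥(maximalRealSubfield L)) (-(θ * N)) θ = hilbertSymbol (v.adicCompletion ↥(maximalRealSubfield L)) N θ := by
    rw [hneg, hilbertSymbol_adicCompletion_mul_left ↥(maximalRealSubfield L) v (neg_ne_zero.2 hθ0) hN0 hθ0, hilbertSymbol_comm (-θ) θ,
      hilbertSymbol_self_neg hθ0, one_mul]
  rw [← hL, h, hR]

end Summit.HodgeConjecture.HodgeConjecture.Cruxes.H413.F0P3cDyRamTokenSignDepthSymbol

end
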